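import Mathlib.Algebra.BigOperators.Fin
import Mathlib.Algebra.Polynomial.Eval.Defs
import Mathlib.Data.ZMod.Basic
import Literature.Computability.Complexity.CircuitComposition
import Literature.Computability.Complexity.CircuitSemantics
import Literature.Computability.Complexity.ConstantDepth
import HarnessLib

/-!
# `ACC⁰ ⊆ P/poly`: unbounded fan-in `∧/∨/¬/MODₘ` circuits as bounded fan-in circuits

Literature / circuit complexity (serves the decomposition of Williams' transfer theorem,
`Williams2014Transfer.lean`, which imports this file and uses `ACC0_subset_PPoly` directly in the
assembly of Williams' Thm. 1.3). Over the tree's straight-line model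
(`Circuit.lean`: a gate carries an arity `k`, a truth table and `k` argument wires, repetitions
allowed; `ACC0 = ⋃_{m ≥ 2} AC0Mod m` bounds the NUMBER OF GATES by a polynomial but not the
fan-in) we prove:

* `Circuit.exists_B2_of_accBasis` — every circuit over `accBasis m` (`0 < m`) with `s` gates on
  `n` inputs has an equivalent circuit over `B₂` (all gates of fan-in `≤ 2`) with at most
  `1 + s · ((4m + 1)(n + s) + m + 2)` gates (`accGateCost`);
* `AC0Mod_subset_PPoly` (`0 < m`) and **`ACC0_subset_PPoly : ACC0 ⊆ PPoly`**
  (Arora–Barak 2009, §6.1 and Def. 14.4; Vollmer 1999, §1.2: a gate of unbounded fan-in over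
  `n + s` wires is a bounded fan-in circuit of size linear in `n + s`). This direct proof
  bypasses the tree's still-open named facts `ACC0_subset_TC0` and `TC0_subset_NC1`
  (`ConstantDepth.lean`), which with the proved `NC1_subset_PPoly` would give the same
  inclusion through `TC⁰ ⊆ NC¹`.

## The construction

A gate of an `accBasis m` circuit is a SYMMETRIC function (`¬`, `∧ₖ`, `∨ₖ`, `MODₘ,ₖ`) of its
`k` argument wires, and `k` is not bounded by the size; but the arguments are drawn from the
`n + s` wires `V = Fin n ⊕ Fin s` (inputs and gates), so the gate is a function of the
multiplicities `argMult w v = #{a | w a = v}`: `∧` is `∀ v` hit by `w`, `u v`; `∨` dually; and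
`MODₘ` depends on `Σ_v [u v] · argMult w v (mod m)` (`numOnes_comp_eq_sum`). Each is computed by
a left-to-right FOLD over an enumeration of `V` with a constant-size state (`cktSize_foldState`:
one Boolean for `∧`/`∨`, a one-hot residue `ZMod m → Bool` for `MODₘ`, shifted by a
multiplexer per residue, `shiftStep`), i.e. by `O(m · (n + s))` gates of fan-in `≤ 2`
(`cktSize_accGate`).
The gates of the circuit are then replaced one by one (`Circuit.exists_B2_of_accBasis`, an
induction along the transcript `transcript` of `CircuitSemantics.lean` with the gate equations
`getD_transcript_eq_gateValue`), in the composition calculus `CktSize` of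
`CircuitComposition.lean`. Mathlib has no Boolean circuits; residues live in Mathlib's `ZMod m`
(`ZMod.natCast_eq_zero_iff`).

## References

* S. Arora, B. Barak, *Computational Complexity: A Modern Approach*, CUP 2009, §6.1 (`P/poly`),
  Def. 14.4 (`ACC0`), §14.4.
* H. Vollmer, *Introduction to Circuit Complexity*, Springer 1999, §1.2 (bounded versus
  unbounded fan-in; symmetric gates).
-/

namespace Literature.Computability.Complexity

open Finset GateList

/-! ### Folding a realizable step map over a list -/

section Fold

variable {V σ : Type*}

/-- The state reached by folding the step maps `F v : state → bit → state` over the list `l`,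
reading the bit `u v` at each `v ∈ l` (a left fold from `init`). [folklore] -/
def foldState (F : V → (σ → Bool) → Bool → (σ → Bool)) (init : σ → Bool) (l : List V)
    (u : V → Bool) : σ → Bool :=
  l.foldl (fun st v => F v st (u v)) init

/-- The empty fold is the initial state. [folklore] -/
@[simp] theorem foldState_nil (F : V → (σ → Bool) → Bool → (σ → Bool)) (init : σ → Bool)
    (u : V → Bool) : foldState F init [] u = init := rfl

/-- The fold of a cons list. [folklore] -/
theorem foldState_cons (F : V → (σ → Bool) → Bool → (σ → Bool)) (init : σ → Bool) (v : V)
    (l : List V) (u : V → Bool) : foldState F init (v :: l) u = foldState F (F v init (u v)) l u :=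
  rfl

/-- One more step of the fold. [folklore] -/
theorem foldState_append_singleton (F : V → (σ → Bool) → Bool → (σ → Bool)) (init : σ → Bool)
    (l : List V) (v : V) (u : V → Bool) :
    foldState F init (l ++ [v]) u = F v (foldState F init l u) (u v) := by
  simp [foldState, List.foldl_append]

/-- A fold with a one-bit state is a Boolean left fold. [folklore] -/
theorem foldState_unit (G : V → Bool → Bool → Bool) (b : Bool) (l : List V) (u : V → Bool) :
    foldState (fun v st bit (_ : Unit) => G v (st ()) bit) (fun _ => b) l u () =
      l.foldl (fun c v => G v c (u v)) b := by
  induction l generalizing b with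
  | nil => rfl
  | cons v l ih =>
    rw [foldState_cons, List.foldl_cons]
    exact ih _

/-- **Folds of realizable steps are realizable, sizes adding**: if every step map
`(state, bit) ↦ F v state bit` has `B₂`-circuits of size `c`, then the map
`u ↦ (u, foldState F init l u)` has `B₂`-circuits of size `card σ + |l| · c` (the initial state
costs `card σ` constant gates; Vollmer 1999, §1.2, composition). [cite: Vollmer1999, §1.2] -/
theorem cktSize_foldState [Fintype σ] {F : V → (σ → Bool) → Bool → (σ → Bool)}
    {init : σ → Bool} {c : ℕ}
    (hF : ∀ v, CktSize B2
      (fun (y : σ ⊕ Unit → Bool) (s : σ) => F v (fun s' => y (.inl s')) (y (.inr ())) s) c)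
    (l : List V) :
    CktSize B2 (fun (u : V → Bool) => Sum.elim u (foldState F init l u))
      (Fintype.card σ + l.length * c) := by
  induction l using List.reverseRecOn with
  | nil =>
    have h1 : CktSize B2 (fun (_ : V → Bool) (s : σ) => init s) (Fintype.card σ * 1) :=
      CktSize.pi_const fun s => cktSize_const V (init s)
    have h2 := (CktSize.id B2).pair h1
    simp only [mul_one, zero_add] at h2
    simpa using h2
  | append_singleton l v ih =>
    have hG : CktSize B2 (fun (y : V ⊕ σ → Bool) =>
        Sum.elim y (fun s => F v (fun s' => y (.inr s')) (y (.inl v)) s)) (0 + c) :=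
      (CktSize.id B2).pair ((hF v).rewire (Sum.elim (fun s' => Sum.inr s') (fun _ => Sum.inl v)))
    have hcomp := (ih.comp hG).outMap
      (Sum.elim (fun v' => Sum.inl (Sum.inl v')) (fun s => Sum.inr s) : V ⊕ σ → (V ⊕ σ) ⊕ σ)
    refine (hcomp.of_le ?_).congr fun u w => ?_
    · simp only [List.length_append, List.length_singleton]
      nlinarith
    · cases w with
      | inl v' => rfl
      | inr s =>
        simp only [Sum.elim_inr, Sum.elim_inl]
        rw [foldState_append_singleton]

end Fold

/-! ### The gates of `accBasis m` over bounded fan-in -/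

section Gates

variable {V : Type*} [Fintype V] [DecidableEq V]

omit [Fintype V] [DecidableEq V] in
/-- A Boolean left fold of guarded conjunctions is `List.all`. [folklore] -/
theorem foldl_and_eq (p f : V → Bool) :
    ∀ (l : List V) (b : Bool),
      l.foldl (fun st v => if p v then st && f v else st) b = (b && l.all fun v => !p v || f v)
  | [], b => by simp
  | v :: l, b => by
    rw [List.foldl_cons, foldl_and_eq p f l, List.all_cons]
    cases p v <;> cases f v <;> cases b <;> simp

omit [Fintype V] [DecidableEq V] in
/-- A Boolean left fold of guarded disjunctions is `List.any`. [folklore] -/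
theorem foldl_or_eq (p f : V → Bool) :
    ∀ (l : List V) (b : Bool),
      l.foldl (fun st v => if p v then st || f v else st) b = (b || l.any fun v => p v && f v)
  | [], b => by simp
  | v :: l, b => by
    rw [List.foldl_cons, foldl_or_eq p f l, List.any_cons]
    cases p v <;> cases f v <;> cases b <;> simp

/-- **Unbounded fan-in conjunction over `B₂`**: `u ↦ ⋀ₐ u (w a)` has `B₂`-circuits with at most
`1 + card V` gates, whatever the fan-in `k` of `w : Fin k → V` (one `∧₂` per position of `V` hit
by `w`; Vollmer 1999, §1.2). [cite: Vollmer1999, §1.2] -/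
theorem cktSize_forall_comp {k : ℕ} (w : Fin k → V) :
    CktSize B2 (fun (u : V → Bool) (_ : Unit) => decide (∀ a, u (w a) = true))
      (1 + Fintype.card V) := by
  let p : V → Bool := fun v => decide (∃ a, w a = v)
  let G : V → Bool → Bool → Bool := fun v c b => if p v then c && b else c
  have hF : ∀ v, CktSize B2 (fun (y : Unit ⊕ Unit → Bool) (_ : Unit) =>
      G v (y (.inl ())) (y (.inr ()))) 1 := by
    intro v
    cases hv : p v with
    | true =>
      exact (cktSize_and (ι := Unit ⊕ Unit) (.inl ()) (.inr ())).congr fun y _ => by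
        simp [G, hv]
    | false =>
      exact ((CktSize.proj B2 fun _ : Unit => (Sum.inl () : Unit ⊕ Unit)).of_le
        (Nat.zero_le 1)).congr fun y _ => by simp [G, hv]
  have hfold := cktSize_foldState (F := fun v st bit (_ : Unit) => G v (st ()) bit)
    (init := fun _ => true) hF (univ : Finset V).toList
  refine ((hfold.outMap fun _ : Unit => (Sum.inr () : V ⊕ Unit)).of_le ?_).congr fun u _ => ?_
  · simp
  · simp only [Sum.elim_inr]
    rw [foldState_unit G true _ u]
    change List.foldl (fun c v => if p v then c && u v else c) true _ = _
    rw [foldl_and_eq p u, Bool.true_and]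
    apply Bool.eq_iff_iff.2
    simp only [List.all_eq_true, Finset.mem_toList, Finset.mem_univ, true_imp_iff,
      Bool.or_eq_true, Bool.not_eq_true', decide_eq_true_eq, p, decide_eq_false_iff_not]
    constructor
    · intro h a
      rcases h (w a) with h' | h'
      · exact absurd ⟨a, rfl⟩ h'
      · exact h'
    · rintro h v
      by_cases hv : ∃ a, w a = v
      · obtain ⟨a, rfl⟩ := hv
        exact Or.inr (h a)
      · exact Or.inl hv

/-- **Unbounded fan-in disjunction over `B₂`**: `u ↦ ⋁ₐ u (w a)` has `B₂`-circuits with at most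
`1 + card V` gates (Vollmer 1999, §1.2). [cite: Vollmer1999, §1.2] -/
theorem cktSize_exists_comp {k : ℕ} (w : Fin k → V) :
    CktSize B2 (fun (u : V → Bool) (_ : Unit) => decide (∃ a, u (w a) = true))
      (1 + Fintype.card V) := by
  let p : V → Bool := fun v => decide (∃ a, w a = v)
  let G : V → Bool → Bool → Bool := fun v c b => if p v then c || b else c
  have hF : ∀ v, CktSize B2 (fun (y : Unit ⊕ Unit → Bool) (_ : Unit) =>
      G v (y (.inl ())) (y (.inr ()))) 1 := by
    intro v
    cases hv : p v with
    | true =>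
      exact (cktSize_or (ι := Unit ⊕ Unit) (.inl ()) (.inr ())).congr fun y _ => by
        simp [G, hv]
    | false =>
      exact ((CktSize.proj B2 fun _ : Unit => (Sum.inl () : Unit ⊕ Unit)).of_le
        (Nat.zero_le 1)).congr fun y _ => by simp [G, hv]
  have hfold := cktSize_foldState (F := fun v st bit (_ : Unit) => G v (st ()) bit)
    (init := fun _ => false) hF (univ : Finset V).toList
  refine ((hfold.outMap fun _ : Unit => (Sum.inr () : V ⊕ Unit)).of_le ?_).congr fun u _ => ?_
  · simp
  · simp only [Sum.elim_inr]
    rw [foldState_unit G false _ u]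
    change List.foldl (fun c v => if p v then c || u v else c) false _ = _
    rw [foldl_or_eq p u, Bool.false_or]
    apply Bool.eq_iff_iff.2
    simp only [List.any_eq_true, Finset.mem_toList, Finset.mem_univ, true_and,
      Bool.and_eq_true, decide_eq_true_eq, p]
    constructor
    · rintro ⟨v, ⟨a, rfl⟩, hv⟩
      exact ⟨a, hv⟩
    · rintro ⟨a, ha⟩
      exact ⟨w a, ⟨a, rfl⟩, ha⟩

/-- The multiplicity of the position `v` among the arguments `w`: the number of argument
places `a` with `w a = v`; this is `Multiset.count v (Finset.univ.val.map w)`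
(`argMult_eq_count`). [folklore] -/
def argMult {k : ℕ} (w : Fin k → V) (v : V) : ℕ := (univ.filter fun a => w a = v).card

omit [Fintype V] in
/-- `argMult w v` is the multiplicity of `v` in the multiset of arguments. [folklore] -/
theorem argMult_eq_count {k : ℕ} (w : Fin k → V) (v : V) :
    argMult w v = Multiset.count v (univ.val.map w) := by
  rw [Multiset.count_map, argMult, Finset.card_def, Finset.filter_val]
  congr 1
  exact Multiset.filter_congr fun _ _ => eq_comm

/-- **Counting fiberwise**: the number of true arguments is the sum over the positions `v` of
`[u v] · argMult w v`. [folklore] -/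
theorem numOnes_comp_eq_sum {k : ℕ} (w : Fin k → V) (u : V → Bool) :
    GateFn.numOnes (fun a => u (w a)) = ∑ v, (if u v = true then argMult w v else 0) := by
  unfold GateFn.numOnes
  rw [card_eq_sum_card_fiberwise (f := w) (t := univ) fun _ _ => mem_univ _]
  refine sum_congr rfl fun v _ => ?_
  rw [filter_filter]
  by_cases hv : u v = true
  · rw [if_pos hv, argMult]
    congr 1
    ext a
    simp only [mem_filter, mem_univ, true_and, and_iff_right_iff_imp]
    intro h
    rw [h, hv]
  · rw [if_neg hv, card_eq_zero]
    ext a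
    simp only [mem_filter, mem_univ, true_and, Finset.notMem_empty, iff_false, not_and]
    intro h h'
    rw [h'] at h
    exact hv h

/-- The one-hot code of a residue (`ZMod m`). [folklore] -/
def oneHot {m : ℕ} (r : ZMod m) : ZMod m → Bool := fun i => decide (i = r)

/-- The cyclic shift of a one-hot state by `c` when the read bit is `true`: output residue `i`
copies input residue `i - c`. [folklore] -/
def shiftStep {m : ℕ} (c : ZMod m) (st : ZMod m → Bool) (b : Bool) : ZMod m → Bool :=
  fun i => if b then st (i - c) else st i

/-- The shift step on a one-hot state adds `c` to the residue when the bit is `true`.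
[folklore] -/
theorem shiftStep_oneHot {m : ℕ} (c r : ZMod m) (b : Bool) :
    shiftStep c (oneHot r) b = oneHot (r + if b then c else 0) := by
  funext i
  cases b with
  | false => simp [shiftStep, oneHot]
  | true => simp [shiftStep, oneHot, sub_eq_iff_eq_add]

/-- The shift step is a multiplexer per residue: `4m` gates of fan-in `≤ 2` (`0 < m`).
[folklore] -/
theorem cktSize_shiftStep {m : ℕ} [NeZero m] (c : ZMod m) :
    CktSize B2 (fun (y : ZMod m ⊕ Unit → Bool) (i : ZMod m) =>
      shiftStep c (fun s' => y (.inl s')) (y (.inr ())) i) (m * 4) := by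
  have h := CktSize.pi_const (B := B2) (κ := ZMod m)
    (f := fun (y : ZMod m ⊕ Unit → Bool) (i : ZMod m) =>
      shiftStep c (fun s' => y (.inl s')) (y (.inr ())) i) (s := 4) fun i =>
    (cktSize_mux (ι := ZMod m ⊕ Unit) (.inr ()) (.inl (i - c)) (.inl i)).congr fun y _ => by
      simp only [shiftStep]
      cases y (.inr ()) <;> simp
  rwa [ZMod.card] at h

omit [Fintype V] [DecidableEq V] in
/-- Folding the shift steps from the one-hot code of `0` yields the one-hot code of the sum of
the shifts at the `true` positions. [folklore] -/
theorem foldState_shift_oneHot {m : ℕ} (c : V → ZMod m) (u : V → Bool) (l : List V) :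
    foldState (fun v st b => shiftStep (c v) st b) (oneHot 0) l u =
      oneHot (l.map fun v => if u v = true then c v else 0).sum := by
  induction l using List.reverseRecOn with
  | nil => simp
  | append_singleton l v ih =>
    rw [foldState_append_singleton, ih, shiftStep_oneHot]
    simp

/-- **Modular counting over `B₂`**: `u ↦ [#{a | u (w a)} ≢ 0 (mod m)]` (the gate `MODₘ,ₖ` wired
along `w : Fin k → V`, `0 < m`) has `B₂`-circuits with at most `m + card V · 4m + 1` gates: a
one-hot residue register (`ZMod m → Bool`) shifted by `argMult w v (mod m)` at every true
position `v`, then one negation of the residue-`0` bit (Vollmer 1999, §1.2).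
[cite: Vollmer1999, §1.2] -/
theorem cktSize_modCount_comp {m k : ℕ} (hm : 0 < m) (w : Fin k → V) :
    CktSize B2 (fun (u : V → Bool) (_ : Unit) =>
      decide (GateFn.numOnes (fun a => u (w a)) % m ≠ 0)) (m + Fintype.card V * (m * 4) + 1) := by
  haveI : NeZero m := ⟨hm.ne'⟩
  let c : V → ZMod m := fun v => (argMult w v : ZMod m)
  have hfold := cktSize_foldState (F := fun v st b => shiftStep (c v) st b) (init := oneHot 0)
    (fun v => cktSize_shiftStep (c v)) (univ : Finset V).toList
  have hnot : CktSize B2 (fun (y : V ⊕ ZMod m → Bool) (_ : Unit) => !y (.inr 0)) 1 :=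
    cktSize_not _
  have h := hfold.comp hnot
  refine (h.of_le ?_).congr fun u _ => ?_
  · simp [ZMod.card]
  · simp only [Sum.elim_inr]
    rw [foldState_shift_oneHot, Finset.sum_map_toList]
    have hsum : (∑ v, if u v = true then c v else 0) =
        ((GateFn.numOnes fun a => u (w a) : ℕ) : ZMod m) := by
      rw [numOnes_comp_eq_sum, Nat.cast_sum]
      refine sum_congr rfl fun v _ => ?_
      split_ifs <;> simp [c]
    rw [hsum]
    simp only [oneHot]
    by_cases h0 : m ∣ GateFn.numOnes (fun a => u (w a))
    · have hz : ((GateFn.numOnes fun a => u (w a) : ℕ) : ZMod m) = 0 :=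
        (ZMod.natCast_eq_zero_iff _ _).2 h0
      have hmod : GateFn.numOnes (fun a => u (w a)) % m = 0 := Nat.mod_eq_zero_of_dvd h0
      simp [hz, hmod]
    · have hz : (0 : ZMod m) ≠ ((GateFn.numOnes fun a => u (w a) : ℕ) : ZMod m) :=
        fun h => h0 ((ZMod.natCast_eq_zero_iff _ _).1 h.symm)
      have hmod : GateFn.numOnes (fun a => u (w a)) % m ≠ 0 :=
        fun h => h0 (Nat.dvd_of_mod_eq_zero h)
      simp [hz, hmod]

/-- A uniform size bound for one gate of `accBasis m` over `N` wires:
`(4m + 1) N + m + 2`. [folklore] -/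
def accGateCost (m N : ℕ) : ℕ := (4 * m + 1) * N + m + 2

/-- `accGateCost` is monotone in the number of wires. [folklore] -/
theorem accGateCost_mono (m : ℕ) {N N' : ℕ} (h : N ≤ N') : accGateCost m N ≤ accGateCost m N' := by
  unfold accGateCost
  have := Nat.mul_le_mul_left (4 * m + 1) h
  omega

/-- **Every gate of `accBasis m` is a bounded fan-in circuit of size linear in the number of
wires it may read** (`0 < m`): for `g ∈ accBasis m` wired along `w : Fin (arity g) → V`, the map
`u ↦ g (u ∘ w)` has `B₂`-circuits with at most `accGateCost m (card V)` gates
(Vollmer 1999, §1.2; Arora–Barak 2009, §14.4). [cite: Vollmer1999, §1.2] -/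
theorem cktSize_accGate {m : ℕ} (hm : 0 < m) {g : GateFn} (hg : g ∈ accBasis m)
    (w : Fin g.1 → V) :
    CktSize B2 (fun (u : V → Bool) (_ : Unit) => g.2 fun a => u (w a))
      (accGateCost m (Fintype.card V)) := by
  simp only [accBasis, acBasis, Set.mem_union, Set.mem_singleton_iff, Set.mem_iUnion,
    Set.mem_insert_iff] at hg
  rcases hg with (rfl | ⟨k, rfl | rfl⟩) | ⟨k, rfl⟩
  · -- negation
    refine ((cktSize_not (w (0 : Fin 1))).of_le ?_).congr fun u _ => rfl
    unfold accGateCost; omega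
  · -- conjunction
    refine ((cktSize_forall_comp w).of_le ?_).congr fun u _ => rfl
    unfold accGateCost; nlinarith
  · -- disjunction
    refine ((cktSize_exists_comp w).of_le ?_).congr fun u _ => rfl
    unfold accGateCost; nlinarith
  · -- modular counting
    refine ((cktSize_modCount_comp hm w).of_le ?_).congr fun u _ => rfl
    unfold accGateCost; nlinarith

end Gates

/-! ### Converting a whole circuit -/

/-- **Every circuit over `accBasis m` (`0 < m`) has an equivalent circuit over `B₂` of size at
most `1 + s · accGateCost m (n + s)`**, `s` the number of gates, `n` the number of inputs: the
gates are replaced one by one by the bounded fan-in circuits of `cktSize_accGate` over the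
`n + s` wires (Arora–Barak 2009, §6.1 and §14.4; Vollmer 1999, §1.2).
[cite: Vollmer1999, §1.2] -/
theorem Circuit.exists_B2_of_accBasis {n m : ℕ} (hm : 0 < m) (C : Circuit (Fin n))
    (hC : C.IsOver (accBasis m)) :
    ∃ D : Circuit (Fin n), D.IsOver B2 ∧ D.size ≤ 1 + C.size * accGateCost m (n + C.size) ∧
      ∀ x, D.eval x = C.eval x := by
  -- notation
  set s := C.gates.length with hs_def
  have hsize : C.size = s := rfl
  let K : ℕ := accGateCost m (n + s)
  let T : (Fin n → Bool) → List Bool := fun x => transcript x [] C.gates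
  let Φ : ℕ → (Fin n → Bool) → Fin n ⊕ Fin s → Bool := fun t x =>
    Sum.elim x fun j => if (j : ℕ) < t then (T x).getD j false else false
  let clamp : 0 < s → Fin n ⊕ ℕ → Fin n ⊕ Fin s := fun hs =>
    Sum.elim Sum.inl fun m' => Sum.inr ⟨m' % s, Nat.mod_lt _ hs⟩
  -- wires into the first `t` gates are read correctly from stage `t`
  have hagree : ∀ (hs : 0 < s) (t : ℕ) (x : Fin n → Bool) (wire : Fin n ⊕ ℕ),
      (∀ m', wire = .inr m' → m' < t) → t ≤ s →
        Φ t x (clamp hs wire) = wireVal x (T x) wire := by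
    intro hs t x wire hw hts
    cases wire with
    | inl i => rfl
    | inr m' =>
      have hm' : m' < t := hw m' rfl
      have hm's : m' % s = m' := Nat.mod_eq_of_lt (lt_of_lt_of_le hm' hts)
      simp only [clamp, Φ, Sum.elim_inr, hm's, hm', if_true]
      rfl
  have hcard : Fintype.card (Fin n ⊕ Fin s) = n + s := by simp
  -- the stages
  have stage : ∀ t : ℕ, t ≤ s → CktSize B2 (Φ t) (1 + t * K) := by
    intro t
    induction t with
    | zero =>
      intro _
      have h0 := ((CktSize.id B2).pair (cktSize_const (Fin n) false)).outMap
        (Sum.elim (fun i => Sum.inl i) (fun _ => Sum.inr ()) : Fin n ⊕ Fin s → Fin n ⊕ Unit)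
      refine (h0.of_le (by simp)).congr fun x w => ?_
      cases w with
      | inl i => rfl
      | inr j => simp [Φ]
    | succ t ih =>
      intro hts
      have ht : t < s := Nat.lt_of_succ_le hts
      have hs : 0 < s := lt_of_le_of_lt (Nat.zero_le t) ht
      set g := C.gates[t] with hg_def
      have hgB : g.fn ∈ accBasis m := hC g (List.getElem_mem ht)
      have hgate : CktSize B2 (fun (u : Fin n ⊕ Fin s → Bool) (_ : Unit) =>
          g.op fun a => u (clamp hs (g.args a))) K := by
        have := cktSize_accGate (V := Fin n ⊕ Fin s) hm hgB fun a => clamp hs (g.args a)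
        rwa [hcard] at this
      have hS : CktSize B2 (fun (u : Fin n ⊕ Fin s → Bool) =>
          Sum.elim u fun (_ : Unit) => g.op fun a => u (clamp hs (g.args a))) (0 + K) :=
        (CktSize.id B2).pair hgate
      have hcomp := ((ih ht.le).comp hS).outMap
        (Sum.elim (fun i => Sum.inl (Sum.inl i))
          (fun j => if (j : ℕ) = t then Sum.inr () else Sum.inl (Sum.inr j)) :
          Fin n ⊕ Fin s → (Fin n ⊕ Fin s) ⊕ Unit)
      refine (hcomp.of_le (le_of_eq (by ring))).congr fun x w => ?_
      cases w with
      | inl i => rfl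
      | inr j =>
        by_cases hj : (j : ℕ) = t
        · -- the new gate: the gate equation of the transcript
          simp only [Sum.elim_inr, hj, if_true]
          have hgoal : (g.op fun a => Φ t x (clamp hs (g.args a))) = (T x).getD t false := by
            rw [getD_transcript_eq_gateValue C x t ht]
            change _ = g.op fun a => wireVal x (T x) (g.args a)
            congr 1
            funext a
            exact hagree hs t x (g.args a) (fun m' hm' => C.wf t ht a m' hm') ht.le
          rw [hgoal]
          simp [Φ, hj]
        · simp only [Sum.elim_inr, hj, if_false, Sum.elim_inl]
          have hiff : ((j : ℕ) < t + 1) ↔ ((j : ℕ) < t) := by omega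
          simp [Φ, hiff]
  have hfinal := stage s le_rfl
  -- the output wire
  have hout : ∃ f : Fin n ⊕ Fin s, ∀ x, Φ s x f = C.eval x := by
    cases ho : C.output with
    | inl i => exact ⟨Sum.inl i, fun x => by rw [eval_eq_wireVal, ho]; rfl⟩
    | inr m' =>
      have hm' : m' < s := C.wf_output m' ho
      have hs : 0 < s := lt_of_le_of_lt (Nat.zero_le m') hm'
      refine ⟨clamp hs (.inr m'), fun x => ?_⟩
      rw [eval_eq_wireVal, ho]
      exact hagree hs s x (.inr m') (fun m'' h => by cases h; exact hm') le_rfl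
  obtain ⟨f, hf⟩ := hout
  obtain ⟨D, hDB, hDs, hDe⟩ := (hfinal.outMap fun _ : Unit => f).toCircuit
  exact ⟨D, hDB, by simpa [hsize, K] using hDs, fun x => (hDe x).trans (hf x)⟩

/-! ### The class inclusions -/

/-- **`AC⁰[m] ⊆ P/poly`** (`0 < m`): a polynomial-size family over `accBasis m` becomes a
polynomial-size family over `B₂` (`Circuit.exists_B2_of_accBasis`; the depth bound is not
needed). (Arora–Barak 2009, §6.1, Def. 14.4; Vollmer 1999, §1.2.) [cite: AroraBarak2009, §6.1 and Def. 14.4] -/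
theorem AC0Mod_subset_PPoly {m : ℕ} (hm : 0 < m) : AC0Mod m ⊆ PPoly := by
  rintro L ⟨d, p, C, hC, hdec⟩
  have main : ∀ n, ∃ D : Circuit (Fin n), D.IsOver B2 ∧
      D.size ≤ 1 + p.eval n * accGateCost m (n + p.eval n) ∧ ∀ x, D.eval x = (C n).eval x := by
    intro n
    obtain ⟨D, hD, hs, he⟩ := (C n).exists_B2_of_accBasis hm (hC n).1
    refine ⟨D, hD, hs.trans ?_, he⟩
    have h1 : (C n).size ≤ p.eval n := (hC n).2.2
    exact Nat.add_le_add_left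
      (Nat.mul_le_mul h1 (accGateCost_mono m (Nat.add_le_add_left h1 n))) 1
  choose D hD using main
  refine Set.mem_iUnion.2 ⟨1 + p * (Polynomial.C (4 * m + 1) * (Polynomial.X + p) +
    Polynomial.C (m + 2)), D, fun n => ⟨(hD n).1, ?_⟩, fun x => ?_⟩
  · have h := (hD n).2.1
    have he : (1 + p * (Polynomial.C (4 * m + 1) * (Polynomial.X + p) +
        Polynomial.C (m + 2))).eval n = 1 + p.eval n * accGateCost m (n + p.eval n) := by
      simp only [Polynomial.eval_add, Polynomial.eval_mul, Polynomial.eval_one,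
        Polynomial.eval_C, Polynomial.eval_X, accGateCost]
      ring
    dsimp only
    rw [he]
    exact h
  · rw [(hD x.length).2.2]
    exact hdec x

/-- **`ACC⁰ ⊆ P/poly`** (Arora–Barak 2009, §6.1 and Def. 14.4: every constant-depth
polynomial-size class over `∧, ∨, ¬, MODₘ` consists of languages with polynomial-size circuits).
Direct gate-by-gate proof (`AC0Mod_subset_PPoly`); the route through the named facts
`ACC0_subset_TC0`, `TC0_subset_NC1` (`ConstantDepth.lean`, open) and the theorem
`NC1_subset_PPoly` is not used. [cite: AroraBarak2009, §6.1 and Def. 14.4] -/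
theorem ACC0_subset_PPoly : ACC0 ⊆ PPoly := by
  intro L hL
  simp only [ACC0, Set.mem_iUnion] at hL
  obtain ⟨m, hm, h⟩ := hL
  exact AC0Mod_subset_PPoly (lt_of_lt_of_le two_pos hm) h

end Literature.Computability.Complexity
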